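import Summits.QuantumFields.YangMills.Theorems.UnitScaleTiltProp7AvgTrueLinearisation
import HarnessLib

/-!
# Route `UnitScaleTilt`, crux K1 child «MinimiserStabilityRegPr» (stmt-QuantumFields-19200), registered stub `stub_prop7From14` (leaf V3 «Prop 7 from a
# background (14)») — THE TRUE ONE-STEP DERIVATIVE OF THE (0.4) AVERAGE VERSUS `covLinAvg`: AN OPERATOR DIFFERENCE OF SIZE `151·α·m`
# (the `α·|Y|` term of p484812 isolated as a LINEAR correction of the operator, not a defect of the linearisation)

Cell `ym3-torus` ∕ fleet seat `ym-ust-19200-p1` (gen 4).  Companion of `UnitScaleTiltProp7AvgTrueLinearisation` (this seat): there the (0.4) average of record at a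
small-field background `U₀` is linearised with the TRUE derivative `T(Y) = D eml(W₀)[i ↦ Y_{U₀}(loop_i)W₀,i]·κ₀* + κ₀·Y_{U₀}(segment)·κ₀*` and a remainder
`≤ 260m²` quadratic in the walk masses.  Here: `‖T(Y) − covLinAvg U₀ Y c‖ ≤ 151·α·m` (`α` the size of the background's loop variables, `m` the common bound of
the `ℓ¹` walk masses of `Y`) — so p484812's operator `covLinAvg` (the derivative at `U₀ = 1` transported) is the true derivative up to an `O(α)`-small LINEAR
operator, and p484812's remainder `400ℓδ(ℓδ + α)` splits as (quadratic, `ℓ²`-along-walks) + (linear, `O(α)`·operator).  For the `ℓ²` route (CARD-19200-V3-g4,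
D1c (ii)): the Euler–Lagrange pairing is exact with `T`; with `covLinAvg` it holds up to `151α·‖μ‖·Σ(masses)`.

WHAT IS PROVED HERE (sorry-free, no definition): `norm_covWalkSum_le_mass` (`‖Y_{U₀}(Γ)‖ ≤ Σ_{s∈Γ}‖Y_{b(s)}‖`), `norm_mean_le'`,
**`norm_trueLin_sub_covLinAvg_le`** (the title), and the corollary **`norm_avgFun_ratio_sub_one_sub_covLinAvg_le_mass`**: p484812's statement with the
remainder `260m² + 151αm` in walk-mass form.  Nothing of Bałaban's is asserted.

References: T. Bałaban, CMP 98 (1985) 17–51 [Balaban1985Averaging] (Prop. 3 (122)–(125) p.36); CMP 109 (1987) 249–301 [Balaban1987RG1] ((0.4), (0.8)).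
-/

noncomputable section

open scoped BigOperators Matrix.Norms.L2Operator

namespace Summit.QuantumFields.YangMills.Theorems.Prop7HolRatioPerStep

open Literature.MathematicalPhysics.QuantumFieldTheory.Balaban1983to89
open T4Continuum BlockAveraging AveragingRT ExpMeanLog LatticeWordStokes B7TransferAnalyticMean BlockAveragingEMLAnalyticMean
open BlockAveragingEMLLinearised BlockAveragingEMLLinearisedBackground

variable {n : Type*} [Fintype n] [DecidableEq n] [Nonempty n] {P : Params} {j : ℕ}

/-- **`‖Y_{U₀}(Γ)‖ ≤ Σ_{s∈Γ}‖Y_{b(s)}‖`** (per-step form of `norm_covWalkSum_le`). [cite: Balaban1985Averaging, (58) p.27 (bookkeeping)] -/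
theorem norm_covWalkSum_le_mass (U₀ : GaugeField P j (Matrix.specialUnitaryGroup n ℂ)) (Y : PBond P j → Matrix n n ℂ) :
    ∀ γ : List (LStep P j), ‖covWalkSum U₀ Y γ‖ ≤ (γ.map fun s => ‖Y s.bond‖).sum
  | [] => by simp
  | s :: γ => by
    rw [covWalkSum_cons, List.map_cons, List.sum_cons]
    calc _ ≤ ‖covStep U₀ Y s‖ + ‖stepFactor U₀ s * covWalkSum U₀ Y γ * star (stepFactor U₀ s)‖ := norm_add_le _ _
      _ ≤ ‖Y s.bond‖ + (γ.map fun s => ‖Y s.bond‖).sum :=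
          add_le_add (norm_covStep_le U₀ Y s) ((norm_conj_stepFactor_le' U₀ s _).trans (norm_covWalkSum_le_mass U₀ Y γ))

omit [Nonempty n] in
/-- The mean of a family is bounded by a common bound of its members. [folklore] -/
theorem norm_mean_le' {ι : Type*} [Fintype ι] [Nonempty ι] {f : ι → Matrix n n ℂ} {B : ℝ} (h : ∀ i, ‖f i‖ ≤ B) :
    ‖((Fintype.card ι : ℂ))⁻¹ • ∑ i, f i‖ ≤ B := by
  have hc : (0 : ℝ) < Fintype.card ι := by exact_mod_cast Fintype.card_pos
  rw [norm_smul, norm_inv, Complex.norm_natCast]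
  calc (Fintype.card ι : ℝ)⁻¹ * ‖∑ i, f i‖ ≤ (Fintype.card ι : ℝ)⁻¹ * ∑ i, ‖f i‖ :=
        mul_le_mul_of_nonneg_left (norm_sum_le _ _) (by positivity)
    _ ≤ (Fintype.card ι : ℝ)⁻¹ * ∑ _i : ι, B := mul_le_mul_of_nonneg_left (Finset.sum_le_sum fun i _ => h i) (by positivity)
    _ = B := by rw [Finset.sum_const, Finset.card_univ, nsmul_eq_mul]; field_simp

/-- **THE TRUE DERIVATIVE VERSUS `covLinAvg`**: with `W₀,i` the background loop variables (within `α ≤ 1/24` of `1`), `κ₀ = eml W₀` the background correction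
factor, `Λ_i = Y_{U₀}(loop_i)`, `Λ_S = Y_{U₀}(segment)`, and every walk mass of `Y` at `c` bounded by `m`:
`‖D eml(W₀)[i ↦ Λ_iW₀,i]·κ₀* + κ₀Λ_Sκ₀* − covLinAvg U₀ Y c‖ ≤ 151·α·m`. [cite: Balaban1985Averaging, Prop. 3 (124) p.36] -/
theorem norm_trueLin_sub_covLinAvg_le (U₀ : GaugeField P j (Matrix.specialUnitaryGroup n ℂ)) (Y : PBond P j → Matrix n n ℂ) (c : PBond P (j + 1)) {m α : ℝ}
    (hmL : ∀ i : Idx P, ((walk (emb c.src) (loopWord P.L c.dir (off i.1) i.2.1 i.2.2)).map fun s => ‖Y s.bond‖).sum ≤ m)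
    (hmS : ((walk (emb c.src) (List.replicate P.L (c.dir, true))).map fun s => ‖Y s.bond‖).sum ≤ m)
    (hα : ∀ i, dist1 (loopHol U₀ c i) ≤ α) (hα24 : α ≤ 1 / 24) (hN : α < deltaSU n) :
    ‖fderiv ℂ (eml : (Idx P → Matrix n n ℂ) → Matrix n n ℂ) (fun i => ((loopHol U₀ c i : Matrix.specialUnitaryGroup n ℂ) : Matrix n n ℂ))
          (fun i => covWalkSum U₀ Y (walk (emb c.src) (loopWord P.L c.dir (off i.1) i.2.1 i.2.2))
            * ((loopHol U₀ c i : Matrix.specialUnitaryGroup n ℂ) : Matrix n n ℂ))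
          * star ((corr (expMeanLogSU (n := n)) U₀ c : Matrix.specialUnitaryGroup n ℂ) : Matrix n n ℂ)
        + ((corr (expMeanLogSU (n := n)) U₀ c : Matrix.specialUnitaryGroup n ℂ) : Matrix n n ℂ)
          * covWalkSum U₀ Y (walk (emb c.src) (List.replicate P.L (c.dir, true)))
          * star ((corr (expMeanLogSU (n := n)) U₀ c : Matrix.specialUnitaryGroup n ℂ) : Matrix n n ℂ)
        - covLinAvg U₀ Y c‖ ≤ 151 * α * m := by
  have hm0 : 0 ≤ m := (List.sum_nonneg fun y hy => by obtain ⟨z, _, rfl⟩ := List.mem_map.mp hy; exact norm_nonneg _).trans hmS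
  have hα0 : 0 ≤ α := (GaugeGroup.dist1_nonneg _).trans (hα (Classical.arbitrary _))
  set W₀ : Idx P → Matrix n n ℂ := fun i => ((loopHol U₀ c i : Matrix.specialUnitaryGroup n ℂ) : Matrix n n ℂ) with hW₀
  set Λ : Idx P → Matrix n n ℂ := fun i => covWalkSum U₀ Y (walk (emb c.src) (loopWord P.L c.dir (off i.1) i.2.1 i.2.2)) with hΛ
  set Vl : Idx P → Matrix n n ℂ := fun i => Λ i * W₀ i with hVl
  set κ₀ : Matrix n n ℂ := ((corr (expMeanLogSU (n := n)) U₀ c : Matrix.specialUnitaryGroup n ℂ) : Matrix n n ℂ) with hκ₀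
  set ΛS : Matrix n n ℂ := covWalkSum U₀ Y (walk (emb c.src) (List.replicate P.L (c.dir, true))) with hΛS
  set mΛ : Matrix n n ℂ := ((Fintype.card (Idx P) : ℂ))⁻¹ • ∑ i, Λ i with hmΛ
  set mVl : Matrix n n ℂ := ((Fintype.card (Idx P) : ℂ))⁻¹ • ∑ i, Vl i with hmVl
  -- sizes
  have hW₀1 : ∀ i, ‖W₀ i - 1‖ ≤ α := fun i => by rw [hW₀, ← FederbushMean.dist1_SU_eq]; exact hα i
  have hW₀n : ∀ i, ‖W₀ i‖ = 1 := fun i => norm_coe_eq_one _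
  have hW₀sup : ‖W₀ - 1‖ ≤ 1 / 24 := pi_norm_le_of_forall (by norm_num) fun i => (hW₀1 i).trans hα24
  have hW₀sup' : ‖W₀ - 1‖ ≤ α := pi_norm_le_of_forall hα0 fun i => hW₀1 i
  have hΛn : ∀ i, ‖Λ i‖ ≤ m := fun i => (norm_covWalkSum_le_mass U₀ Y _).trans (hmL i)
  have hVln : ∀ i, ‖Vl i‖ ≤ m := fun i => (norm_mul_le _ _).trans (by rw [hW₀n, mul_one]; exact hΛn i)
  have hVlsup : ‖Vl‖ ≤ m := pi_norm_le_of_forall hm0 hVln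
  have hΛSn : ‖ΛS‖ ≤ m := (norm_covWalkSum_le_mass U₀ Y _).trans hmS
  have hmΛn : ‖mΛ‖ ≤ m := norm_mean_le' hΛn
  have hκ₀1 : ‖κ₀ - 1‖ ≤ 2 * α := by
    rw [hκ₀, ← FederbushMean.dist1_SU_eq]
    exact BlockAveragingEMLProp2.dist1_corr_le_two_mul U₀ c hα hN (hα24.trans (by norm_num))
  have hκ₀s1 : ‖star κ₀ - 1‖ ≤ 2 * α := by rw [← star_one, ← star_sub, norm_star]; exact hκ₀1
  have hκ₀sn : ‖star κ₀‖ = 1 := by rw [norm_star]; exact norm_coe_eq_one _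
  -- (1) `D eml(W₀)[Vl] − mean Vl`
  have h1 : ‖fderiv ℂ (eml : (Idx P → Matrix n n ℂ) → Matrix n n ℂ) W₀ Vl - mVl‖ ≤ 144 * m * α := by
    have h := norm_fderiv_eml_sub_mean_le hW₀sup Vl
    rw [meanCLM_apply] at h
    refine h.trans ?_
    nlinarith [mul_le_mul hVlsup hW₀sup' (norm_nonneg _) hm0, norm_nonneg (W₀ - 1), norm_nonneg Vl]
  -- (2) `mean Vl − mean Λ = mean (Λ·(W₀ − 1))`
  have h2 : ‖mVl - mΛ‖ ≤ m * α := by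
    have e : mVl - mΛ = ((Fintype.card (Idx P) : ℂ))⁻¹ • ∑ i, Λ i * (W₀ i - 1) := by
      rw [hmVl, hmΛ, ← smul_sub, ← Finset.sum_sub_distrib]
      congr 1
      exact Finset.sum_congr rfl fun i _ => by rw [hVl]; noncomm_ring
    rw [e]
    exact norm_mean_le' fun i => (norm_mul_le _ _).trans (mul_le_mul (hΛn i) (hW₀1 i) (norm_nonneg _) hm0)
  -- (3) the algebra
  have e : fderiv ℂ (eml : (Idx P → Matrix n n ℂ) → Matrix n n ℂ) W₀ Vl * star κ₀ + κ₀ * ΛS * star κ₀ - (mΛ + ΛS)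
      = (fderiv ℂ (eml : (Idx P → Matrix n n ℂ) → Matrix n n ℂ) W₀ Vl - mVl) * star κ₀ + (mVl - mΛ) * star κ₀ + mΛ * (star κ₀ - 1)
        + (κ₀ - 1) * ΛS * star κ₀ + ΛS * (star κ₀ - 1) := by noncomm_ring
  have hlin : covLinAvg U₀ Y c = mΛ + ΛS := rfl
  rw [hlin, e]
  calc _ ≤ ‖fderiv ℂ (eml : (Idx P → Matrix n n ℂ) → Matrix n n ℂ) W₀ Vl - mVl‖ * ‖star κ₀‖ + ‖mVl - mΛ‖ * ‖star κ₀‖ + ‖mΛ‖ * ‖star κ₀ - 1‖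
          + ‖κ₀ - 1‖ * ‖ΛS‖ * ‖star κ₀‖ + ‖ΛS‖ * ‖star κ₀ - 1‖ := by
        refine (norm_add_le _ _).trans (add_le_add ?_ (norm_mul_le _ _))
        refine (norm_add_le _ _).trans (add_le_add ?_ ((norm_mul_le _ _).trans (mul_le_mul_of_nonneg_right (norm_mul_le _ _) (norm_nonneg _))))
        refine (norm_add_le _ _).trans (add_le_add ?_ (norm_mul_le _ _))
        exact (norm_add_le _ _).trans (add_le_add (norm_mul_le _ _) (norm_mul_le _ _))
    _ ≤ 144 * m * α * 1 + m * α * 1 + m * (2 * α) + 2 * α * m * 1 + m * (2 * α) := by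
        rw [hκ₀sn]
        have := mul_le_mul hκ₀1 hΛSn (norm_nonneg _) (by positivity)
        nlinarith [h1, h2, mul_le_mul hmΛn hκ₀s1 (norm_nonneg _) hm0, mul_le_mul hΛSn hκ₀s1 (norm_nonneg _) hm0,
          norm_nonneg (fderiv ℂ (eml : (Idx P → Matrix n n ℂ) → Matrix n n ℂ) W₀ Vl - mVl), norm_nonneg (mVl - mΛ), norm_nonneg mΛ,
          norm_nonneg (star κ₀ - 1), norm_nonneg (κ₀ - 1), norm_nonneg ΛS]
    _ = 151 * α * m := by ring

/-- **p484812 IN WALK-MASS FORM**: under the hypotheses of `norm_avgFun_ratio_sub_one_sub_trueLin_le` (walk masses `≤ m`, `72m ≤ 1`, loop variables of `U₀`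
within `α ≤ 1/24`, `3m + α < δ_N`): `‖Ū(c)Ū₀(c)* − 1 − covLinAvg U₀ Y c‖ ≤ 260m² + 151αm` — the remainder of the linearisation by `covLinAvg` split into its
quadratic part (walk masses squared) and its `α`-linear part (operator correction). [cite: Balaban1985Averaging, Prop. 3 (122)-(124) p.36] -/
theorem norm_avgFun_ratio_sub_one_sub_covLinAvg_le_mass (U₀ U : GaugeField P j (Matrix.specialUnitaryGroup n ℂ)) (c : PBond P (j + 1)) {m α : ℝ}
    (hmL : ∀ i : Idx P, ((walk (emb c.src) (loopWord P.L c.dir (off i.1) i.2.1 i.2.2)).map fun s => ‖pertVar U₀ U s.bond‖).sum ≤ m)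
    (hmS : ((walk (emb c.src) (List.replicate P.L (c.dir, true))).map fun s => ‖pertVar U₀ U s.bond‖).sum ≤ m)
    (hm72 : 72 * m ≤ 1) (hα : ∀ i, dist1 (loopHol U₀ c i) ≤ α) (hα24 : α ≤ 1 / 24) (hN : 3 * m + α < deltaSU n) :
    ‖((avgFun (expMeanLogSU (n := n)) U c : Matrix.specialUnitaryGroup n ℂ) : Matrix n n ℂ) *
          star ((avgFun (expMeanLogSU (n := n)) U₀ c : Matrix.specialUnitaryGroup n ℂ) : Matrix n n ℂ) - 1 -
        covLinAvg U₀ (pertVar U₀ U) c‖ ≤ 260 * m ^ 2 + 151 * α * m := by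
  have hm0 : 0 ≤ m := (List.sum_nonneg fun y hy => by obtain ⟨z, _, rfl⟩ := List.mem_map.mp hy; exact norm_nonneg _).trans hmS
  have h1 := norm_avgFun_ratio_sub_one_sub_trueLin_le U₀ U c hmL hmS hm72 hα hα24 hN
  have h2 := norm_trueLin_sub_covLinAvg_le U₀ (pertVar U₀ U) c hmL hmS hα hα24 (by linarith)
  have key : ∀ (A T Lc : Matrix n n ℂ), ‖A - Lc‖ ≤ ‖A - T‖ + ‖T - Lc‖ := fun A T Lc => by
    calc ‖A - Lc‖ = ‖(A - T) + (T - Lc)‖ := by rw [sub_add_sub_cancel]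
      _ ≤ ‖A - T‖ + ‖T - Lc‖ := norm_add_le _ _
  exact (key _ _ _).trans (add_le_add h1 h2)

end Summit.QuantumFields.YangMills.Theorems.Prop7HolRatioPerStep

end
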